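import Mathlib
import HarnessLib
import Summits.HubbardSuperconductivity.HubbardSuperconductivity.Theorems.KLProgrammeKLRegimeEngineTowerInstUVLev

/-!
# Route `KLProgramme` — crux K3 ENGINE (stmt-HubbardSuperconductivity-20437 `KLRegimeEngineV17F2`), stub (b) v2, THE LEVELS PACKAGE (ℓ), instantiation (I2)/(I3):
# THE LEVELLED MEASURED PROFILE WITH THE BLOCK RATE KEPT — `Q′ = C₂²·2^{−(d−1)}·max Q Q_uv` (kit-compatible: `4Q′ ≤ Q` for `d` large), degree-capped
# (cell gate-hubbard-kl, seat p4 g18; memo HOME/prover-p4/F1-HMU-SQUEEZE.md §7)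

`klTowerMuLev_le_profile[_of_levelZero]` (…InstProfileLev / …InstUVLev) and their capped twins `…D` (…InstProfileLevCapped) bound the measured profile with
`Q′ = C₂²·max Q Q_uv` — valid, but they discard the block gain: the kit's numerics (`hu₁ : 4Q′ ≤ Q` in `towerBorn_le_law_tracks_of_profile`) need `Q′` SMALLER than
`Q/4`, which the re-measurement affords because every re-measured block and the UV datum carry at least the factor `((√2)^{d−1})⁻¹^{2p+t−6}` (`dk − 1 ≥ d − 1`,
`(√2)^e·(((√2)^d)⁻¹)^e = (((√2)^{d−1})⁻¹)^e`).  Keeping it: for every `(t, p) ≠ (0, 3)`, `3 ≤ p ≤ D`,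
`klTowerMuLevAt … d t k p ≤ A′·λ^{p−1}·Q′^p` with **`A′ = 27⁵·(C₁/C₂)·8^{d−1}·(A_uv + A/(1 − ((√2)^d)⁻¹))`, `Q′ = C₂²·(2^{d−1})⁻¹·max Q Q_uv`** — the shape of part 9′'s
`hA′ge`/`hQ′ge` (`A′ ≳ c₁A/((1−r)r^{bo})` with `r^{−bo} = (√2)^{d(6−t)} ≤ 8^d`, `Q′ ≳ c₂r^aQ = c₂2^{−d}Q`).

* §1 `sqrt_two_pow_mul_inv_pow_eq` (`(√2)^e(((√2)^d)⁻¹)^e = (((√2)^{d−1})⁻¹)^e`), `rateGain_le` (`(((√2)^{d−1})⁻¹)^{2p+t−6} ≤ 8^{d−1}·((2^{d−1})⁻¹)^p`);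
* §2 **`klTowerMuLevAt_le_profileR`** (per track, capped), §3 **`klTowerMuLev_le_profileR`** (track-blind: `m ≥ 4`; `m = 3` modulo the located cell
  `klTowerMuLevAt … d 0 k 3` = «(I2)-F1-HMU»), **`klTowerMuLev_le_profileR_of_levelZero`** (UV datum from `KernelNormsLevels … K 0`: `A_uv = ε_x`, `Q_uv = Qe.CE/ε_x²`).
Compositions of landed theorems and real algebra; nothing about the model is asserted beyond them; nothing asserts (ℓ), any stub, K3 or superconductivity.
References: BGM 2006 §2.8 (2.83), (2.93)–(2.98) [cite: BenfattoGiulianiMastropietro2006].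
-/

noncomputable section

namespace Summit.HubbardSuperconductivity.HubbardSuperconductivity.Theorems.EngineV8

set_option linter.dupNamespace false -- summit = problem name (single-conjunct summit), D-0017

open Classical
open Real Finset Literature.MathematicalPhysics.QuantumLattice Literature.Probability.LatticeModels GrassmannAlgebra
open Literature.MathematicalPhysics.QuantumLattice.FermiRG
open Summit.HubbardSuperconductivity.HubbardSuperconductivity.Theorems.KLProgrammeLegKernels
open Summit.HubbardSuperconductivity.HubbardSuperconductivity.Theorems.KLRegimeSplit
open Summit.HubbardSuperconductivity.HubbardSuperconductivity.Theorems.KLRegimeWick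
open Summit.HubbardSuperconductivity.HubbardSuperconductivity.Theorems.TorusFourierL2
open Summit.HubbardSuperconductivity.HubbardSuperconductivity.Theorems.DispersionFlow
open Summit.HubbardSuperconductivity.HubbardSuperconductivity.Theorems.PerturbedFermiCurve

/-! ## §1 The block gain -/

/-- `(√2)^e·(((√2)^d)⁻¹)^e = (((√2)^{d−1})⁻¹)^e` for `1 ≤ d`. -/
theorem sqrt_two_pow_mul_inv_pow_eq {d : ℕ} (hd : 1 ≤ d) (e : ℕ) :
    Real.sqrt 2 ^ e * ((Real.sqrt 2 ^ d)⁻¹) ^ e = ((Real.sqrt 2 ^ (d - 1))⁻¹) ^ e := by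
  have hs0 : 0 < Real.sqrt 2 := Real.sqrt_pos.2 (by norm_num)
  rw [← mul_pow]
  congr 1
  obtain ⟨d', rfl⟩ : ∃ d', d = d' + 1 := ⟨d - 1, by omega⟩
  rw [Nat.add_sub_cancel, pow_succ]
  field_simp

/-- **The gain of one re-measured block, split between `Q′^p` and `A′`**: for `p ≥ 3`, `t ≥ 0`,
`(((√2)^{d−1})⁻¹)^{2p+t−6} ≤ 8^{d−1}·((2^{d−1})⁻¹)^p` (any `d`). -/
theorem rateGain_le {d p t : ℕ} (hp : 3 ≤ p) :
    ((Real.sqrt 2 ^ (d - 1))⁻¹) ^ (2 * p + t - 6) ≤ (8 : ℝ) ^ (d - 1) * (((2 : ℝ) ^ (d - 1))⁻¹) ^ p := by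
  have hs1 : 1 ≤ Real.sqrt 2 := Real.one_le_sqrt.2 (by norm_num)
  set γ : ℝ := (Real.sqrt 2 ^ (d - 1))⁻¹ with hγ
  have hγ0 : 0 ≤ γ := by positivity
  have hγ1 : γ ≤ 1 := inv_le_one_of_one_le₀ (one_le_pow₀ hs1)
  -- drop the `t` part
  have h1 : γ ^ (2 * p + t - 6) ≤ γ ^ (2 * (p - 3)) := pow_le_pow_of_le_one hγ0 hγ1 (by omega)
  refine h1.trans (le_of_eq ?_)
  -- `γ² = (2^{d−1})⁻¹`
  have hγ2 : γ ^ 2 = ((2 : ℝ) ^ (d - 1))⁻¹ := by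
    rw [hγ, inv_pow, ← pow_mul, mul_comm, pow_mul, Real.sq_sqrt (by norm_num : (0 : ℝ) ≤ 2)]
  rw [pow_mul, hγ2]
  -- `δ^{p−3} = 8^{d−1}·δ^p`, `δ = (2^{d−1})⁻¹`
  have h2 : (0 : ℝ) < (2 : ℝ) ^ (d - 1) := by positivity
  obtain ⟨q, rfl⟩ : ∃ q, p = q + 3 := ⟨p - 3, by omega⟩
  rw [Nat.add_sub_cancel, pow_add, inv_pow, inv_pow]
  have h8 : (8 : ℝ) ^ (d - 1) = ((2 : ℝ) ^ (d - 1)) ^ 3 := by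
    rw [← pow_mul, mul_comm, pow_mul]; norm_num
  rw [h8]
  field_simp

variable {L M : ℕ} [NeZero L] [NeZero M]

/-! ## §2 The per-track measured profile with the rate, capped -/

omit [NeZero L] [NeZero M] in
/-- **THE LEVELLED MEASURED PROFILE FROM THE LAW, per track, RATE KEPT.**  Under the binders of H1, for `d ≥ 2`, `k ≥ 1`, `dk − 1 ≤ nScales β + 1`, a degree cap
`D`, nonnegative `A, λ, Q, A_uv, Q_uv`, carrier bounds `N₀ t p` with the UV law `N₀ t p / klLevUnit … t p 0 ≤ A_uv λ^{p−1} Q_uv^p` (`3 ≤ p`) and the law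
`klTowerBLev … d t k′ p ≤ A λ^{p−1} Q^p` (`1 ≤ k′ ≤ k`, all tracks, `3 ≤ p ≤ D`): for every `t : Fin 5`, `3 ≤ p ≤ D` with `2p + t ≥ 7`,
`klTowerMuLevAt … d t k p ≤ 27⁵(C₁/C₂)·8^{d−1}·(A_uv + A/(1 − ((√2)^d)⁻¹))·λ^{p−1}·(C₂²(2^{d−1})⁻¹·max Q Q_uv)^p`. [cite: BenfattoGiulianiMastropietro2006, §2.8 (2.83), (2.93)-(2.98)] -/
theorem klTowerMuLevAt_le_profileR :
    ∃ C₁ C₂ : ℝ, 0 < C₁ ∧ 0 < C₂ ∧ ∀ R : RenConsts, R.WF2 → ∃ c₃' : ℝ, 0 < c₃' ∧ ∃ U₀' : ℝ, 0 < U₀' ∧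
      ∀ (P : SplitConsts) (c : ℝ), P.WF → 0 < c → c ≤ klEngC₃6 P R → c ≤ c₃' →
      ∀ μ ∈ klWindowC, ∀ U : ℝ, 0 < U → U ≤ klEngU₀9 P R c → U ≤ U₀' → ∀ β : ℝ, klBetaMin ≤ β → β ≤ Real.exp (c / U ^ 2) →
      ∀ K : TrigPolyC4v, FrameOK R U (nScales β) μ K → ∀ (L M : ℕ) [NeZero L] [NeZero M],
      klEngL₃ β U ≤ L → klEngM₃ β U L ≤ M → ∀ d k : ℕ, 2 ≤ d → 1 ≤ k → d * k - 1 ≤ nScales β + 1 → ∀ D : ℕ,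
      ∀ (A lam Q Auv Quv : ℝ), 0 ≤ A → 0 ≤ lam → 0 ≤ Q → 0 ≤ Auv → 0 ≤ Quv →
      ∀ N₀ : Fin 5 → ℕ → ℝ, (∀ t p, 0 ≤ N₀ t p) →
        (∀ (t : Fin 5) (p : ℕ) (Ωe' : Fin (2 * p) → Option (SectorLeg (sectorCount 0))), levelCount Ωe' = (t : ℕ) + 1 →
          klAnisoLegKernelNormAt L M β U μ K klE0 0 (2 * p) Ωe' ≤ N₀ t p) →
        (∀ (t : Fin 5) (p : ℕ), 3 ≤ p → N₀ t p / klLevUnit β M t p 0 ≤ Auv * lam ^ (p - 1) * Quv ^ p) →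
        (∀ k' : ℕ, 1 ≤ k' → k' ≤ k → ∀ (t : Fin 5) (p : ℕ), 3 ≤ p → p ≤ D → klTowerBLev L M β U μ K d t k' p ≤ A * lam ^ (p - 1) * Q ^ p) →
      ∀ (t : Fin 5) (p : ℕ), 3 ≤ p → p ≤ D → 7 ≤ 2 * p + (t : ℕ) →
        klTowerMuLevAt L M β U μ K d t k p ≤
          (27 : ℝ) ^ 5 * (C₁ / C₂) * (8 : ℝ) ^ (d - 1) * (Auv + A / (1 - (Real.sqrt 2 ^ d)⁻¹)) * lam ^ (p - 1) *
            (C₂ ^ 2 * ((2 : ℝ) ^ (d - 1))⁻¹ * max Q Quv) ^ p := by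
  obtain ⟨C₁, C₂, hC₁, hC₂, h⟩ := klTowerMuLevAt_le_kitSum
  refine ⟨C₁, C₂, hC₁, hC₂, fun R hR2 => ?_⟩
  obtain ⟨c₃, hc₃, U₀, hU₀, h'⟩ := h R hR2
  refine ⟨c₃, hc₃, U₀, hU₀, ?_⟩
  intro P c hP hc hc6 hc₃' μ hμ U hU hU9 hU₀' β hβmin hβc K hK L M _ _ hL3 hM3 d k hd hk1 hkN D A lam Q Auv Quv hA hlam hQ hAuv hQuv N₀ hN0 hcar hUV hIH
    t p hp hpD hpt
  have hβ : 0 < β := KLRegimeSplit.pos_of_klBetaMin_le hβmin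
  have ht4 : (t : ℕ) ≤ 4 := by have := t.isLt; omega
  have hs1 : 1 ≤ Real.sqrt 2 := Real.one_le_sqrt.2 (by norm_num)
  have hs0 : 0 < Real.sqrt 2 := by positivity
  -- the rate `ρ = ((√2)^d)⁻¹ ∈ (0, 1)` and the block gain `γ = ((√2)^{d−1})⁻¹ ≤ 1`
  set ρ : ℝ := (Real.sqrt 2 ^ d)⁻¹ with hρ
  have hsd1 : 1 < Real.sqrt 2 ^ d := by
    have h2 : Real.sqrt 2 ^ 2 = 2 := Real.sq_sqrt (by norm_num)
    calc (1 : ℝ) < 2 := by norm_num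
      _ = Real.sqrt 2 ^ 2 := h2.symm
      _ ≤ Real.sqrt 2 ^ d := pow_le_pow_right₀ hs1 hd
  have hρ0 : 0 < ρ := by positivity
  have hρ1 : ρ < 1 := inv_lt_one_of_one_lt₀ hsd1
  have hρle : ρ ≤ 1 := hρ1.le
  have h1ρ : 0 < 1 - ρ := sub_pos.2 hρ1
  set γ : ℝ := (Real.sqrt 2 ^ (d - 1))⁻¹ with hγ
  have hγ0 : 0 ≤ γ := by positivity
  have hγ1 : γ ≤ 1 := inv_le_one_of_one_le₀ (one_le_pow₀ hs1)
  -- the exponent `e = 2p + t − 6 ≥ 1` and the gain `G = γ^e`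
  set e : ℕ := 2 * p + (t : ℕ) - 6 with he
  have he1 : 1 ≤ e := by omega
  set G : ℝ := γ ^ e with hG
  have hG0 : 0 ≤ G := by positivity
  have hGle : G ≤ (8 : ℝ) ^ (d - 1) * (((2 : ℝ) ^ (d - 1))⁻¹) ^ p := by
    rw [hG, hγ, he]; exact rateGain_le hp
  have hmain := h' P c hP hc hc6 hc₃' μ hμ U hU hU9 hU₀' β hβmin hβc K hK L M hL3 hM3 d k hd hk1 hkN t p (by omega) (by omega) (N₀ t p)
    (hN0 t p) (hcar t p)
  rw [← he] at hmain
  -- laws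
  set law : ℕ → ℝ := fun p => A * lam ^ (p - 1) * Q ^ p with hlaw
  have hlaw0 : 0 ≤ law p := by positivity
  have hu0 : 0 < klLevUnit β M t p 0 := klLevUnit_pos hβ t p 0
  -- (i) the UV term carries `γ^e` (since `dk − 1 ≥ d − 1`)
  have hUVt : (Real.sqrt 2 ^ e)⁻¹ ^ (d * k - 1) * (N₀ t p / klLevUnit β M t p 0) ≤ G * (Auv * lam ^ (p - 1) * Quv ^ p) := by
    have hb : (Real.sqrt 2 ^ e)⁻¹ ≤ 1 := inv_le_one_of_one_le₀ (one_le_pow₀ hs1)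
    have hb0 : 0 ≤ (Real.sqrt 2 ^ e)⁻¹ := by positivity
    have hdk : d - 1 ≤ d * k - 1 := by
      have : d * 1 ≤ d * k := Nat.mul_le_mul_left d hk1
      omega
    have hpow : (Real.sqrt 2 ^ e)⁻¹ ^ (d * k - 1) ≤ (Real.sqrt 2 ^ e)⁻¹ ^ (d - 1) := pow_le_pow_of_le_one hb0 hb hdk
    have hGeq : (Real.sqrt 2 ^ e)⁻¹ ^ (d - 1) = G := by
      rw [hG, hγ, inv_pow, inv_pow, ← pow_mul, ← pow_mul, mul_comm]
    have hq0 : 0 ≤ N₀ t p / klLevUnit β M t p 0 := div_nonneg (hN0 t p) hu0.le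
    calc (Real.sqrt 2 ^ e)⁻¹ ^ (d * k - 1) * (N₀ t p / klLevUnit β M t p 0) ≤ G * (N₀ t p / klLevUnit β M t p 0) := by
          rw [← hGeq]; exact mul_le_mul_of_nonneg_right hpow hq0
      _ ≤ G * (Auv * lam ^ (p - 1) * Quv ^ p) := mul_le_mul_of_nonneg_left (hUV t p hp) hG0
  -- (ii) the born sum: each term `≤ G·ρ^{k−1−k′}·law`, the sum `≤ G·law/(1−ρ)`
  have hterm : ∀ k' ∈ range k, Real.sqrt 2 ^ e * ρ ^ (e * (k - k')) * klTowerBLev L M β U μ K d t (k' + 1) p ≤ G * ρ ^ (k - 1 - k') * law p := by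
    intro k' hk'
    rw [mem_range] at hk'
    obtain ⟨n, hn⟩ : ∃ n, k - k' = n + 1 := ⟨k - k' - 1, by omega⟩
    have hkn : k - 1 - k' = n := by omega
    have hb : klTowerBLev L M β U μ K d t (k' + 1) p ≤ law p := hIH (k' + 1) (by omega) (by omega) t p hp hpD
    have hb0 : 0 ≤ klTowerBLev L M β U μ K d t (k' + 1) p := klTowerBLev_nonneg hβ U μ K d t (k' + 1) p
    have hrate : Real.sqrt 2 ^ e * ρ ^ (e * (k - k')) ≤ G * ρ ^ (k - 1 - k') := by
      rw [hn, hkn, show e * (n + 1) = e + e * n by ring, pow_add, ← mul_assoc]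
      have h1 : Real.sqrt 2 ^ e * ρ ^ e = G := by rw [hG, hγ, hρ]; exact sqrt_two_pow_mul_inv_pow_eq (by omega) e
      have h2 : ρ ^ (e * n) ≤ ρ ^ n := by
        rw [mul_comm, pow_mul]
        exact pow_le_of_le_one (by positivity) (pow_le_one₀ hρ0.le hρle) (by omega)
      rw [h1]
      exact mul_le_mul_of_nonneg_left h2 hG0
    calc Real.sqrt 2 ^ e * ρ ^ (e * (k - k')) * klTowerBLev L M β U μ K d t (k' + 1) p
        ≤ G * ρ ^ (k - 1 - k') * klTowerBLev L M β U μ K d t (k' + 1) p := mul_le_mul_of_nonneg_right hrate hb0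
      _ ≤ G * ρ ^ (k - 1 - k') * law p := mul_le_mul_of_nonneg_left hb (by positivity)
  have hsum : ∑ k' ∈ range k, Real.sqrt 2 ^ e * ρ ^ (e * (k - k')) * klTowerBLev L M β U μ K d t (k' + 1) p ≤ G * (law p / (1 - ρ)) := by
    refine (sum_le_sum hterm).trans ?_
    have hre : ∑ k' ∈ range k, G * ρ ^ (k - 1 - k') * law p = G * ((∑ j ∈ range k, ρ ^ j) * law p) := by
      rw [← sum_range_reflect (fun j => ρ ^ j) k, sum_mul, mul_sum]
      refine sum_congr rfl fun k' _ => ?_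
      ring
    rw [hre]
    refine mul_le_mul_of_nonneg_left ?_ hG0
    calc (∑ j ∈ range k, ρ ^ j) * law p ≤ 1 / (1 - ρ) * law p :=
          mul_le_mul_of_nonneg_right (geom_sum_range_le_inv_one_sub hρ0.le hρ1 k) hlaw0
      _ = law p / (1 - ρ) := by rw [one_div, inv_mul_eq_div]
  -- (iii) assemble
  have hpre0 : 0 ≤ (27 : ℝ) ^ ((t : ℕ) + 1) * (C₁ * C₂ ^ (2 * p - 1)) := by positivity
  have h27 : (27 : ℝ) ^ ((t : ℕ) + 1) ≤ 27 ^ 5 := pow_le_pow_right₀ (by norm_num) (by omega)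
  set Mq := max Q Quv with hMq
  have hQM : Q ≤ Mq := le_max_left _ _
  have hQuvM : Quv ≤ Mq := le_max_right _ _
  have hMq0 : 0 ≤ Mq := hQ.trans hQM
  set δ : ℝ := ((2 : ℝ) ^ (d - 1))⁻¹ with hδ
  have hδ0 : 0 ≤ δ := by positivity
  have hin : Auv * lam ^ (p - 1) * Quv ^ p + law p / (1 - ρ) ≤ (Auv + A / (1 - ρ)) * lam ^ (p - 1) * Mq ^ p := by
    have h1 : Auv * lam ^ (p - 1) * Quv ^ p ≤ Auv * lam ^ (p - 1) * Mq ^ p :=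
      mul_le_mul_of_nonneg_left (pow_le_pow_left₀ hQuv hQuvM p) (by positivity)
    have h2 : law p / (1 - ρ) ≤ A / (1 - ρ) * lam ^ (p - 1) * Mq ^ p := by
      rw [hlaw]; dsimp only
      rw [div_eq_mul_inv, show A / (1 - ρ) * lam ^ (p - 1) * Mq ^ p = A * lam ^ (p - 1) * Mq ^ p * (1 - ρ)⁻¹ by ring]
      exact mul_le_mul_of_nonneg_right (mul_le_mul_of_nonneg_left (pow_le_pow_left₀ hQ hQM p) (by positivity))
        (inv_nonneg.2 h1ρ.le)
    calc Auv * lam ^ (p - 1) * Quv ^ p + law p / (1 - ρ) ≤ Auv * lam ^ (p - 1) * Mq ^ p + A / (1 - ρ) * lam ^ (p - 1) * Mq ^ p :=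
          add_le_add h1 h2
      _ = (Auv + A / (1 - ρ)) * lam ^ (p - 1) * Mq ^ p := by ring
  have hA0 : 0 ≤ Auv + A / (1 - ρ) := by have : 0 ≤ A / (1 - ρ) := div_nonneg hA h1ρ.le; positivity
  have hin0 : 0 ≤ (Auv + A / (1 - ρ)) * lam ^ (p - 1) * Mq ^ p := by positivity
  have hC : C₁ * C₂ ^ (2 * p - 1) = C₁ / C₂ * (C₂ ^ 2) ^ p := by
    have hpw : (C₂ ^ 2) ^ p = C₂ ^ (2 * p - 1) * C₂ := by
      rw [← pow_mul, ← pow_succ]; congr 1; omega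
    rw [hpw]
    field_simp
  calc klTowerMuLevAt L M β U μ K d t k p
      ≤ (27 : ℝ) ^ ((t : ℕ) + 1) * (C₁ * C₂ ^ (2 * p - 1)) *
          ((Real.sqrt 2 ^ e)⁻¹ ^ (d * k - 1) * (N₀ t p / klLevUnit β M t p 0) +
            ∑ k' ∈ range k, Real.sqrt 2 ^ e * ρ ^ (e * (k - k')) * klTowerBLev L M β U μ K d t (k' + 1) p) := hmain
    _ ≤ (27 : ℝ) ^ ((t : ℕ) + 1) * (C₁ * C₂ ^ (2 * p - 1)) * (G * (Auv * lam ^ (p - 1) * Quv ^ p) + G * (law p / (1 - ρ))) :=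
        mul_le_mul_of_nonneg_left (add_le_add hUVt hsum) hpre0
    _ = (27 : ℝ) ^ ((t : ℕ) + 1) * (C₁ * C₂ ^ (2 * p - 1)) * G * (Auv * lam ^ (p - 1) * Quv ^ p + law p / (1 - ρ)) := by ring
    _ ≤ (27 : ℝ) ^ 5 * (C₁ * C₂ ^ (2 * p - 1)) * ((8 : ℝ) ^ (d - 1) * δ ^ p) * ((Auv + A / (1 - ρ)) * lam ^ (p - 1) * Mq ^ p) := by
        have hsum0 : 0 ≤ Auv * lam ^ (p - 1) * Quv ^ p + law p / (1 - ρ) := add_nonneg (by positivity) (div_nonneg hlaw0 h1ρ.le)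
        have h1 : (27 : ℝ) ^ ((t : ℕ) + 1) * (C₁ * C₂ ^ (2 * p - 1)) * G ≤ 27 ^ 5 * (C₁ * C₂ ^ (2 * p - 1)) * ((8 : ℝ) ^ (d - 1) * δ ^ p) :=
          mul_le_mul (mul_le_mul_of_nonneg_right h27 (by positivity)) hGle hG0 (by positivity)
        exact mul_le_mul h1 hin hsum0 (by positivity)
    _ = (27 : ℝ) ^ 5 * (C₁ / C₂) * (8 : ℝ) ^ (d - 1) * (Auv + A / (1 - ρ)) * lam ^ (p - 1) * (C₂ ^ 2 * δ * Mq) ^ p := by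
        rw [hC, mul_pow, mul_pow]; ring

/-! ## §3 The track-blind profile with the rate: `hprof`, `hprof3` modulo the located cell, UV discharged -/

omit [NeZero L] [NeZero M] in
/-- **THE TRACK-BLIND MEASURED PROFILE, RATE KEPT, capped**: (a) `m ∈ [4, D]`: `klTowerMuLev … d k m ≤ A′λ^{m−1}Q′^m`; (b) `m = 3 ≤ D`: given `X ≥ klTowerMuLevAt … d 0 k 3`
(the located cell), `klTowerMuLev … d k 3 ≤ max X (A′λ²Q′³)`; `A′ = 27⁵(C₁/C₂)8^{d−1}(A_uv + A/(1−((√2)^d)⁻¹))`, `Q′ = C₂²(2^{d−1})⁻¹·max Q Q_uv`.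
[cite: BenfattoGiulianiMastropietro2006, §2.8 (2.83), (2.93)-(2.98)] -/
theorem klTowerMuLev_le_profileR :
    ∃ C₁ C₂ : ℝ, 0 < C₁ ∧ 0 < C₂ ∧ ∀ R : RenConsts, R.WF2 → ∃ c₃' : ℝ, 0 < c₃' ∧ ∃ U₀' : ℝ, 0 < U₀' ∧
      ∀ (P : SplitConsts) (c : ℝ), P.WF → 0 < c → c ≤ klEngC₃6 P R → c ≤ c₃' →
      ∀ μ ∈ klWindowC, ∀ U : ℝ, 0 < U → U ≤ klEngU₀9 P R c → U ≤ U₀' → ∀ β : ℝ, klBetaMin ≤ β → β ≤ Real.exp (c / U ^ 2) →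
      ∀ K : TrigPolyC4v, FrameOK R U (nScales β) μ K → ∀ (L M : ℕ) [NeZero L] [NeZero M],
      klEngL₃ β U ≤ L → klEngM₃ β U L ≤ M → ∀ d k : ℕ, 2 ≤ d → 1 ≤ k → d * k - 1 ≤ nScales β + 1 → ∀ D : ℕ,
      ∀ (A lam Q Auv Quv : ℝ), 0 ≤ A → 0 ≤ lam → 0 ≤ Q → 0 ≤ Auv → 0 ≤ Quv →
      ∀ N₀ : Fin 5 → ℕ → ℝ, (∀ t p, 0 ≤ N₀ t p) →
        (∀ (t : Fin 5) (p : ℕ) (Ωe' : Fin (2 * p) → Option (SectorLeg (sectorCount 0))), levelCount Ωe' = (t : ℕ) + 1 →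
          klAnisoLegKernelNormAt L M β U μ K klE0 0 (2 * p) Ωe' ≤ N₀ t p) →
        (∀ (t : Fin 5) (p : ℕ), 3 ≤ p → N₀ t p / klLevUnit β M t p 0 ≤ Auv * lam ^ (p - 1) * Quv ^ p) →
        (∀ k' : ℕ, 1 ≤ k' → k' ≤ k → ∀ (t : Fin 5) (p : ℕ), 3 ≤ p → p ≤ D → klTowerBLev L M β U μ K d t k' p ≤ A * lam ^ (p - 1) * Q ^ p) →
      (∀ m : ℕ, 4 ≤ m → m ≤ D →
        klTowerMuLev L M β U μ K d k m ≤
          (27 : ℝ) ^ 5 * (C₁ / C₂) * (8 : ℝ) ^ (d - 1) * (Auv + A / (1 - (Real.sqrt 2 ^ d)⁻¹)) * lam ^ (m - 1) *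
            (C₂ ^ 2 * ((2 : ℝ) ^ (d - 1))⁻¹ * max Q Quv) ^ m) ∧
      (∀ X : ℝ, 3 ≤ D → klTowerMuLevAt L M β U μ K d 0 k 3 ≤ X →
        klTowerMuLev L M β U μ K d k 3 ≤
          max X ((27 : ℝ) ^ 5 * (C₁ / C₂) * (8 : ℝ) ^ (d - 1) * (Auv + A / (1 - (Real.sqrt 2 ^ d)⁻¹)) * lam ^ 2 *
            (C₂ ^ 2 * ((2 : ℝ) ^ (d - 1))⁻¹ * max Q Quv) ^ 3)) := by
  obtain ⟨C₁, C₂, hC₁, hC₂, h⟩ := klTowerMuLevAt_le_profileR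
  refine ⟨C₁, C₂, hC₁, hC₂, fun R hR2 => ?_⟩
  obtain ⟨c₃, hc₃, U₀, hU₀, h'⟩ := h R hR2
  refine ⟨c₃, hc₃, U₀, hU₀, ?_⟩
  intro P c hP hc hc6 hc₃' μ hμ U hU hU9 hU₀' β hβmin hβc K hK L M _ _ hL3 hM3 d k hd hk1 hkN D A lam Q Auv Quv hA hlam hQ hAuv hQuv N₀ hN0 hcar hUV hIH
  have hcell := h' P c hP hc hc6 hc₃' μ hμ U hU hU9 hU₀' β hβmin hβc K hK L M hL3 hM3 d k hd hk1 hkN D A lam Q Auv Quv hA hlam hQ hAuv hQuv N₀ hN0 hcar hUV hIH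
  refine ⟨fun m hm hmD => ?_, fun X hD3 hX => ?_⟩
  · obtain ⟨t, ht⟩ := exists_klTowerMuLev_eq (L := L) (M := M) β U μ K d k m
    rw [ht]
    exact hcell t m (by omega) hmD (by omega)
  · obtain ⟨t, ht⟩ := exists_klTowerMuLev_eq (L := L) (M := M) β U μ K d k 3
    rw [ht]
    by_cases ht0 : (t : ℕ) = 0
    · have : t = 0 := Fin.ext ht0
      rw [this]
      exact hX.trans (le_max_left _ _)
    · have h7 : 7 ≤ 2 * 3 + (t : ℕ) := by omega
      have := hcell t 3 le_rfl hD3 h7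
      exact this.trans (le_max_right _ _)

omit [NeZero L] [NeZero M] in
/-- **THE TRACK-BLIND LEVELLED PROFILE, RATE KEPT, UV DATUM FROM `KernelNormsLevels … K 0`** (capped): with `0 ≤ Qe.CE`, `KernelNormsLevels L M P Qe β U μ K 0`,
`epsCoupling P U 0 ≤ λ` and the law on the blocks `1 ≤ k′ ≤ k` (`3 ≤ p ≤ D`): (a) `m ∈ [4, D]`: `klTowerMuLev … d k m ≤ A′λ^{m−1}Q′^m`; (b) `3 ≤ D`,
`klTowerMuLevAt … d 0 k 3 ≤ X`: `klTowerMuLev … d k 3 ≤ max X (A′λ²Q′³)`; `A′ = 27⁵(C₁/C₂)8^{d−1}(ε_x + A/(1−((√2)^d)⁻¹))`, `Q′ = C₂²(2^{d−1})⁻¹·max Q (Qe.CE/ε_x²)`,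
`ε_x = imagTimeWeight β M`.  These are the `hprof`/`hprof3` rows of `towerBorn_le_law_tracks_of_profile` for the levelled model, modulo the located cell.
[cite: BenfattoGiulianiMastropietro2006, §2.8 (2.83), (2.93)-(2.98)] -/
theorem klTowerMuLev_le_profileR_of_levelZero :
    ∃ C₁ C₂ : ℝ, 0 < C₁ ∧ 0 < C₂ ∧ ∀ R : RenConsts, R.WF2 → ∃ c₃' : ℝ, 0 < c₃' ∧ ∃ U₀' : ℝ, 0 < U₀' ∧
      ∀ (P : SplitConsts) (c : ℝ), P.WF → 0 < c → c ≤ klEngC₃6 P R → c ≤ c₃' →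
      ∀ μ ∈ klWindowC, ∀ U : ℝ, 0 < U → U ≤ klEngU₀9 P R c → U ≤ U₀' → ∀ β : ℝ, klBetaMin ≤ β → β ≤ Real.exp (c / U ^ 2) →
      ∀ K : TrigPolyC4v, FrameOK R U (nScales β) μ K → ∀ (L M : ℕ) [NeZero L] [NeZero M],
      klEngL₃ β U ≤ L → klEngM₃ β U L ≤ M → ∀ d k : ℕ, 2 ≤ d → 1 ≤ k → d * k - 1 ≤ nScales β + 1 → ∀ D : ℕ,
      ∀ (Qe : EngConsts), 0 ≤ Qe.CE → KernelNormsLevels L M P Qe β U μ K 0 →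
      ∀ (A lam Q : ℝ), 0 ≤ A → 0 ≤ Q → epsCoupling P U 0 ≤ lam →
        (∀ k' : ℕ, 1 ≤ k' → k' ≤ k → ∀ (t : Fin 5) (p : ℕ), 3 ≤ p → p ≤ D → klTowerBLev L M β U μ K d t k' p ≤ A * lam ^ (p - 1) * Q ^ p) →
      (∀ m : ℕ, 4 ≤ m → m ≤ D →
        klTowerMuLev L M β U μ K d k m ≤
          (27 : ℝ) ^ 5 * (C₁ / C₂) * (8 : ℝ) ^ (d - 1) * (imagTimeWeight β M + A / (1 - (Real.sqrt 2 ^ d)⁻¹)) * lam ^ (m - 1) *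
            (C₂ ^ 2 * ((2 : ℝ) ^ (d - 1))⁻¹ * max Q (Qe.CE / imagTimeWeight β M ^ 2)) ^ m) ∧
      (∀ X : ℝ, 3 ≤ D → klTowerMuLevAt L M β U μ K d 0 k 3 ≤ X →
        klTowerMuLev L M β U μ K d k 3 ≤
          max X ((27 : ℝ) ^ 5 * (C₁ / C₂) * (8 : ℝ) ^ (d - 1) * (imagTimeWeight β M + A / (1 - (Real.sqrt 2 ^ d)⁻¹)) * lam ^ 2 *
            (C₂ ^ 2 * ((2 : ℝ) ^ (d - 1))⁻¹ * max Q (Qe.CE / imagTimeWeight β M ^ 2)) ^ 3)) := by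
  obtain ⟨C₁, C₂, hC₁, hC₂, h⟩ := klTowerMuLev_le_profileR
  refine ⟨C₁, C₂, hC₁, hC₂, fun R hR2 => ?_⟩
  obtain ⟨c₃, hc₃, U₀, hU₀, h'⟩ := h R hR2
  refine ⟨c₃, hc₃, U₀, hU₀, ?_⟩
  intro P c hP hc hc6 hc₃' μ hμ U hU hU9 hU₀' β hβmin hβc K hK L M _ _ hL3 hM3 d k hd hk1 hkN D Qe hCE h0 A lam Q hA hQ hεl hIH
  have hβ : 0 < β := KLRegimeSplit.pos_of_klBetaMin_le hβmin
  have hK0 : 0 ≤ P.Klam := le_trans zero_le_one hP.1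
  have hε0 : 0 ≤ epsCoupling P U 0 := by unfold epsCoupling; positivity
  have hlam : 0 ≤ lam := hε0.trans hεl
  have hx : 0 < imagTimeWeight β M := by
    unfold imagTimeWeight
    have : (0 : ℝ) < M := Nat.cast_pos.2 (Nat.pos_of_ne_zero (NeZero.ne M))
    positivity
  have hQuv : 0 ≤ Qe.CE / imagTimeWeight β M ^ 2 := by positivity
  exact h' P c hP hc hc6 hc₃' μ hμ U hU hU9 hU₀' β hβmin hβc K hK L M hL3 hM3 d k hd hk1 hkN D A lam Q (imagTimeWeight β M)
    (Qe.CE / imagTimeWeight β M ^ 2) hA hlam hQ hx.le hQuv (fun t p => klTowerMeasLev L M β U μ K d 0 (2 * p) ((t : ℕ) + 1))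
    (fun t p => klTowerMeasLev_nonneg hβ.le U μ K d 0 (2 * p) _)
    (fun t p Ωe' hlev => klAnisoLegKernelNormAt_le_klTowerMeasLev_zero β U μ K d t p Ωe' hlev)
    (fun t p hp => (div_le_div_of_nonneg_right (klTowerMeasLev_zero_le_of_kernelNormsLevels h0 hCE hε0 d hp _) (klLevUnit_pos hβ t p 0).le).trans
      (uvLaw_div_klLevUnit_zero_le hβ hCE hε0 hεl t (by omega)))
    hIH

end Summit.HubbardSuperconductivity.HubbardSuperconductivity.Theorems.EngineV8

end
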